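import Mathlib
import HarnessLib
import Summits.CriticalPhenomena.SAWScalingLimit.Theorems.SAWTowerCountSpectralPinExpSum

/-!
# SpectralPin, analytic core: termwise identification of the level-2 coefficient, and limit extraction
(route `SAWTowerCount`, support item stmt-CriticalPhenomena-7259 `SpectralPin`; helper, `--supports`).

Abstract (SAW-free) form of Steps 4–7 of the exponential-fitting argument.

**Static core (Steps 6–7).**  Data: a function `Φ` with a three-term exponential expansion at rates
`bπ, (b+1)π, (b+2)π` up to `O(e^{−(b+3)πm})` (the shape delivered by `PoissonKernelExpansion`), and
a finite exponential sum `a · ∑_{k ≤ K} c_k e^{−(ψ + g_k) m}` (`g_0 = 0`, `c_0 = 1`, a uniform gap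
`g_k ≥ δ₀ > 0` for `k ≥ 1`, all `g_k ≤ 5π/4` except possibly the single window index `k₂`)
approximating `Φ` up to `C₀ a e^{−(ψ+9π/4)m}` on `m ≥ 1` (the shape delivered by the limit of
`LevelTwoSolitude`-type representations).  Conclusion (`levelTwo_coefficient`): `ψ = bπ` and the
continuum level-2 coefficient `κ K₂` equals the window term's coefficient `a c_{k₂}` if `g_{k₂} = 2π`
and vanishes otherwise.  Consequently (`levelTwo_minor`), over a 2×2 grid of rows on which the
window coefficients are rank one, the kernel `κ K₂` has vanishing 2×2 minor.  Uses Lemma U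
(`expSum_fiber_eq_zero`).

**Limit extraction (Steps 4–5).**  For each `n` we are given such a representation of four
functions `f n p q` (`p q : Fin 2`) on `m ≥ 1` with depth `τ n m → m`, shared rates, coefficients
`|c| ≤ C₀`, the window coefficients `a c_{k₂}` rank one over the grid, A PRIORI BOUNDS
`ψ n ∈ [ψlo, ψhi]`, `a n p q ∈ [alo, ahi]`, `alo > 0` (supplied by `SAWTowerCountSpectralPinBounds`),
and pointwise convergence `f n p q m → Φ p q m`.  Passing to the limit along a non-principal
ultrafilter on `ℕ` (every bounded coordinate converges, integer coordinates are eventually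
constant) yields the data of the static core, whence the 2×2 minor of `κ K₂` vanishes
(`levelTwo_minor_of_sequences`).  Mathlib only; no cited facts.
-/

noncomputable section

namespace Summit.CriticalPhenomena.SAWScalingLimit.Theorems.SpectralPin

open Filter Topology Finset

/-- Lemma U over a `Fintype`, `ite` form: the total coefficient at any rate `v < ρ` vanishes. -/
theorem expSum_ite_eq_zero {ι : Type*} [Fintype ι] [DecidableEq ι] (r α : ι → ℝ) (ρ C M : ℝ)
    (h : ∀ m : ℝ, M ≤ m → |∑ i, α i * Real.exp (-(r i * m))| ≤ C * Real.exp (-(ρ * m)))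
    (v : ℝ) (hv : v < ρ) : ∑ i, (if r i = v then α i else 0) = 0 := by
  rw [← Finset.sum_filter]
  exact expSum_fiber_eq_zero Finset.univ r α ρ C M h v hv

/-- Monotonicity of `x ↦ e^{−x m}` for `m ≥ 0`. -/
theorem exp_neg_mul_le_of_le {x ρ m : ℝ} (hx : ρ ≤ x) (hm : 0 ≤ m) :
    Real.exp (-(x * m)) ≤ Real.exp (-(ρ * m)) :=
  Real.exp_le_exp.mpr (neg_le_neg (mul_le_mul_of_nonneg_right hx hm))

/-- **Static core of SpectralPin (one pair of rows).** See the module docstring (`b > 0` is not even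
needed: only `π > 0` and the ordering of the rates enter). -/
theorem levelTwo_coefficient (b δ₀ : ℝ) (hδ₀ : 0 < δ₀)
    (κ K₁ K₂ C_P m_P : ℝ) (hκ : 0 < κ) (Φ : ℝ → ℝ)
    (hPKE : ∀ m : ℝ, m_P ≤ m →
      |Φ m - κ * (Real.exp (-(b * Real.pi * m)) + K₁ * Real.exp (-((b + 1) * Real.pi * m)) +
        K₂ * Real.exp (-((b + 2) * Real.pi * m)))| ≤ C_P * Real.exp (-((b + 3) * Real.pi * m)))
    (Ks k₂ : ℕ) (hk₂ : k₂ ≤ Ks) (ψ : ℝ) (g : ℕ → ℝ) (hg0 : g 0 = 0)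
    (hgap : ∀ k, 1 ≤ k → k ≤ Ks → δ₀ ≤ g k)
    (hwin : ∀ k, k ≤ Ks → k ≠ k₂ → g k ≤ 5 / 4 * Real.pi)
    (a : ℝ) (ha : 0 < a) (c : ℕ → ℝ) (hc0 : c 0 = 1) (C₀ : ℝ)
    (hlim : ∀ m : ℝ, 1 ≤ m →
      |Φ m - a * ∑ k ∈ Finset.range (Ks + 1), c k * Real.exp (-((ψ + g k) * m))| ≤
        C₀ * a * Real.exp (-((ψ + 9 / 4 * Real.pi) * m))) :
    ψ = b * Real.pi ∧ κ * K₂ = (if g k₂ = 2 * Real.pi then a * c k₂ else 0) := by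
  have hπ := Real.pi_pos
  -- nonnegativity of all gaps
  have hgnn : ∀ k, k ≤ Ks → 0 ≤ g k := by
    intro k hk
    rcases Nat.eq_zero_or_pos k with h0 | hpos
    · rw [h0, hg0]
    · exact hδ₀.le.trans (hgap k hpos hk)
  -- the combined exponential sum over `ι = Fin (Ks+1) ⊕ Fin 3`
  set ρ : ℝ := min (ψ + 9 / 4 * Real.pi) ((b + 3) * Real.pi) with hρ
  let r : Fin (Ks + 1) ⊕ Fin 3 → ℝ := fun i => match i with
    | Sum.inl k => ψ + g k
    | Sum.inr j => ![b * Real.pi, (b + 1) * Real.pi, (b + 2) * Real.pi] j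
  let α : Fin (Ks + 1) ⊕ Fin 3 → ℝ := fun i => match i with
    | Sum.inl k => a * c k
    | Sum.inr j => ![-κ, -(κ * K₁), -(κ * K₂)] j
  have hsum : ∀ m : ℝ, ∑ i, α i * Real.exp (-(r i * m)) =
      a * ∑ k ∈ Finset.range (Ks + 1), c k * Real.exp (-((ψ + g k) * m)) -
      κ * (Real.exp (-(b * Real.pi * m)) + K₁ * Real.exp (-((b + 1) * Real.pi * m)) +
        K₂ * Real.exp (-((b + 2) * Real.pi * m))) := by
    intro m
    rw [Fintype.sum_sum_type]
    have h1 : ∑ k : Fin (Ks + 1), α (Sum.inl k) * Real.exp (-(r (Sum.inl k) * m)) =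
        a * ∑ k ∈ Finset.range (Ks + 1), c k * Real.exp (-((ψ + g k) * m)) := by
      rw [Finset.mul_sum, Finset.sum_range]
      refine Finset.sum_congr rfl fun k _ => ?_
      simp only [r, α]
      ring
    have h2 : ∑ j : Fin 3, α (Sum.inr j) * Real.exp (-(r (Sum.inr j) * m)) =
        -(κ * (Real.exp (-(b * Real.pi * m)) + K₁ * Real.exp (-((b + 1) * Real.pi * m)) +
          K₂ * Real.exp (-((b + 2) * Real.pi * m)))) := by
      rw [Fin.sum_univ_three]
      simp only [r, α, Matrix.cons_val_zero, Matrix.cons_val_one, Matrix.cons_val_two,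
        Matrix.head_cons, Matrix.tail_cons]
      ring
    rw [h1, h2]
    ring
  have hU : ∀ m : ℝ, max 1 m_P ≤ m →
      |∑ i, α i * Real.exp (-(r i * m))| ≤ (C₀ * a + C_P) * Real.exp (-(ρ * m)) := by
    intro m hm
    have hm1 : 1 ≤ m := le_trans (le_max_left _ _) hm
    have hmP : m_P ≤ m := le_trans (le_max_right _ _) hm
    have hm0 : 0 ≤ m := zero_le_one.trans hm1
    rw [hsum m]
    have h1 := hlim m hm1
    have h2 := hPKE m hmP
    have e1 : Real.exp (-((ψ + 9 / 4 * Real.pi) * m)) ≤ Real.exp (-(ρ * m)) :=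
      exp_neg_mul_le_of_le (min_le_left _ _) hm0
    have e2 : Real.exp (-((b + 3) * Real.pi * m)) ≤ Real.exp (-(ρ * m)) :=
      exp_neg_mul_le_of_le (min_le_right _ _) hm0
    have hC₀a : 0 ≤ C₀ * a := by
      have := (abs_nonneg _).trans h1
      have hpos : 0 < Real.exp (-((ψ + 9 / 4 * Real.pi) * m)) := Real.exp_pos _
      nlinarith
    have hCP : 0 ≤ C_P := by
      have := (abs_nonneg _).trans h2
      have hpos : 0 < Real.exp (-((b + 3) * Real.pi * m)) := Real.exp_pos _
      nlinarith
    calc |a * ∑ k ∈ Finset.range (Ks + 1), c k * Real.exp (-((ψ + g k) * m)) -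
          κ * (Real.exp (-(b * Real.pi * m)) + K₁ * Real.exp (-((b + 1) * Real.pi * m)) +
            K₂ * Real.exp (-((b + 2) * Real.pi * m)))|
        ≤ |Φ m - a * ∑ k ∈ Finset.range (Ks + 1), c k * Real.exp (-((ψ + g k) * m))| +
          |Φ m - κ * (Real.exp (-(b * Real.pi * m)) + K₁ * Real.exp (-((b + 1) * Real.pi * m)) +
            K₂ * Real.exp (-((b + 2) * Real.pi * m)))| := by
          rw [abs_sub_comm (Φ m) (a * _)]
          exact abs_sub_le _ _ _
      _ ≤ C₀ * a * Real.exp (-((ψ + 9 / 4 * Real.pi) * m)) +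
          C_P * Real.exp (-((b + 3) * Real.pi * m)) := add_le_add h1 h2
      _ ≤ C₀ * a * Real.exp (-(ρ * m)) + C_P * Real.exp (-(ρ * m)) :=
          add_le_add (mul_le_mul_of_nonneg_left e1 hC₀a) (mul_le_mul_of_nonneg_left e2 hCP)
      _ = (C₀ * a + C_P) * Real.exp (-(ρ * m)) := by ring
  have hfib := expSum_ite_eq_zero r α ρ (C₀ * a + C_P) (max 1 m_P) hU
  -- evaluation of the fiber sums
  have heval : ∀ v : ℝ, ∑ i, (if r i = v then α i else 0) =
      (∑ k : Fin (Ks + 1), if ψ + g k = v then a * c k else 0) +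
      ((if b * Real.pi = v then -κ else 0) + (if (b + 1) * Real.pi = v then -(κ * K₁) else 0) +
        (if (b + 2) * Real.pi = v then -(κ * K₂) else 0)) := by
    intro v
    rw [Fintype.sum_sum_type, Fin.sum_univ_three]
    simp only [r, α, Matrix.cons_val_zero, Matrix.cons_val_one, Matrix.cons_val_two,
      Matrix.head_cons, Matrix.tail_cons]
  -- Step 6a: `ψ = bπ`
  have hψ : ψ = b * Real.pi := by
    rcases lt_trichotomy ψ (b * Real.pi) with hlt | heq | hgt
    · exfalso
      have hv : ψ < ρ := lt_min (by linarith) (by nlinarith)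
      have h0 := hfib ψ hv
      rw [heval] at h0
      have hlat : (∑ k : Fin (Ks + 1), if ψ + g k = ψ then a * c k else 0) = a := by
        rw [Fintype.sum_eq_single (⟨0, Nat.succ_pos _⟩ : Fin (Ks + 1))]
        · simp [hg0, hc0]
        · intro k hk
          have hk1 : 1 ≤ (k : ℕ) := by
            rcases Nat.eq_zero_or_pos k with h0 | hpos
            · exact absurd (Fin.ext h0) hk
            · exact hpos
          have := hgap k hk1 (Nat.lt_succ_iff.mp k.isLt)
          rw [if_neg]; linarith
      rw [hlat, if_neg (show ¬ b * Real.pi = ψ by intro h; linarith),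
        if_neg (show ¬ (b + 1) * Real.pi = ψ by intro h; nlinarith),
        if_neg (show ¬ (b + 2) * Real.pi = ψ by intro h; nlinarith)] at h0
      linarith
    · exact heq
    · exfalso
      have hv : b * Real.pi < ρ := lt_min (by nlinarith) (by nlinarith)
      have h0 := hfib (b * Real.pi) hv
      rw [heval] at h0
      have hlat : (∑ k : Fin (Ks + 1), if ψ + g k = b * Real.pi then a * c k else 0) = 0 := by
        refine Finset.sum_eq_zero fun k _ => ?_
        have := hgnn k (Nat.lt_succ_iff.mp k.isLt)
        rw [if_neg]; linarith
      rw [hlat, if_pos rfl, if_neg (show ¬ (b + 1) * Real.pi = b * Real.pi by intro h; nlinarith),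
        if_neg (show ¬ (b + 2) * Real.pi = b * Real.pi by intro h; nlinarith)] at h0
      linarith
  refine ⟨hψ, ?_⟩
  -- Step 6b: the fiber at `(b+2)π = ψ + 2π`
  have hv : (b + 2) * Real.pi < ρ := by
    refine lt_min ?_ (by nlinarith)
    rw [hψ]; nlinarith
  have h0 := hfib ((b + 2) * Real.pi) hv
  rw [heval] at h0
  have hlat : (∑ k : Fin (Ks + 1), if ψ + g k = (b + 2) * Real.pi then a * c k else 0) =
      (if g k₂ = 2 * Real.pi then a * c k₂ else 0) := by
    rw [Fintype.sum_eq_single (⟨k₂, Nat.lt_succ_of_le hk₂⟩ : Fin (Ks + 1))]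
    · simp only
      by_cases hg : g k₂ = 2 * Real.pi
      · rw [if_pos (by rw [hψ, hg]; ring), if_pos hg]
      · rw [if_neg, if_neg hg]
        intro h; apply hg; rw [hψ] at h; linarith
    · intro k hk
      have hk' : (k : ℕ) ≠ k₂ := fun h => hk (Fin.ext h)
      have := hwin k (Nat.lt_succ_iff.mp k.isLt) hk'
      rw [if_neg]
      rw [hψ]; nlinarith
  rw [hlat, if_neg (show ¬ b * Real.pi = (b + 2) * Real.pi by intro h; nlinarith),
    if_neg (show ¬ (b + 1) * Real.pi = (b + 2) * Real.pi by intro h; nlinarith), if_pos rfl] at h0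
  linarith

/-- **Static core of SpectralPin (2×2 grid of rows).** With the data of `levelTwo_coefficient` for
four pairs of rows `(p,q) ∈ Fin 2 × Fin 2` sharing the rates (`ψ`, `g`, window index `k₂`), and the
window coefficients `a_{pq} c_{k₂,pq}` rank one over the grid, the continuum level-2 kernel
`κ_{pq} K₂,_{pq}` has vanishing 2×2 minor. -/
theorem levelTwo_minor (b δ₀ : ℝ) (hδ₀ : 0 < δ₀)
    (κ K₁ K₂ : Fin 2 → Fin 2 → ℝ) (C_P m_P : ℝ) (hκ : ∀ p q, 0 < κ p q)
    (Φ : Fin 2 → Fin 2 → ℝ → ℝ)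
    (hPKE : ∀ p q, ∀ m : ℝ, m_P ≤ m →
      |Φ p q m - κ p q * (Real.exp (-(b * Real.pi * m)) +
        K₁ p q * Real.exp (-((b + 1) * Real.pi * m)) +
        K₂ p q * Real.exp (-((b + 2) * Real.pi * m)))| ≤ C_P * Real.exp (-((b + 3) * Real.pi * m)))
    (Ks k₂ : ℕ) (hk₂ : k₂ ≤ Ks) (ψ : ℝ) (g : ℕ → ℝ) (hg0 : g 0 = 0)
    (hgap : ∀ k, 1 ≤ k → k ≤ Ks → δ₀ ≤ g k)
    (hwin : ∀ k, k ≤ Ks → k ≠ k₂ → g k ≤ 5 / 4 * Real.pi)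
    (a : Fin 2 → Fin 2 → ℝ) (ha : ∀ p q, 0 < a p q) (c : ℕ → Fin 2 → Fin 2 → ℝ)
    (hc0 : ∀ p q, c 0 p q = 1) (C₀ : ℝ)
    (hrank : (a 0 0 * c k₂ 0 0) * (a 1 1 * c k₂ 1 1) = (a 0 1 * c k₂ 0 1) * (a 1 0 * c k₂ 1 0))
    (hlim : ∀ p q, ∀ m : ℝ, 1 ≤ m →
      |Φ p q m - a p q * ∑ k ∈ Finset.range (Ks + 1), c k p q * Real.exp (-((ψ + g k) * m))| ≤
        C₀ * a p q * Real.exp (-((ψ + 9 / 4 * Real.pi) * m))) :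
    (κ 0 0 * K₂ 0 0) * (κ 1 1 * K₂ 1 1) = (κ 0 1 * K₂ 0 1) * (κ 1 0 * K₂ 1 0) := by
  have H : ∀ p q, κ p q * K₂ p q = (if g k₂ = 2 * Real.pi then a p q * c k₂ p q else 0) :=
    fun p q => (levelTwo_coefficient b δ₀ hδ₀ (κ p q) (K₁ p q) (K₂ p q) C_P m_P (hκ p q)
      (Φ p q) (hPKE p q) Ks k₂ hk₂ ψ g hg0 hgap hwin (a p q) (ha p q) (fun k => c k p q)
      (hc0 p q) C₀ (hlim p q)).2
  rw [H 0 0, H 1 1, H 0 1, H 1 0]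
  by_cases hg : g k₂ = 2 * Real.pi
  · simp only [if_pos hg]; exact hrank
  · simp only [if_neg hg, mul_zero]

/-! ### Limit extraction along an ultrafilter -/

/-- Along an ultrafilter on `ℕ`, a real sequence eventually confined to `[lo, hi]` converges to a
point of `[lo, hi]` (compactness of `Icc`). -/
theorem exists_tendsto_ultrafilter_of_bounds (𝒰 : Ultrafilter ℕ) (u : ℕ → ℝ) (lo hi : ℝ)
    (h : ∀ᶠ n in (𝒰 : Filter ℕ), lo ≤ u n ∧ u n ≤ hi) :
    ∃ x, lo ≤ x ∧ x ≤ hi ∧ Tendsto u 𝒰 (𝓝 x) := by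
  have hle : (↑(𝒰.map u) : Filter ℝ) ≤ 𝓟 (Set.Icc lo hi) := by
    rw [Ultrafilter.coe_map, le_principal_iff, Filter.mem_map]
    exact h
  obtain ⟨x, hx, hxle⟩ := isCompact_Icc.ultrafilter_le_nhds (𝒰.map u) hle
  refine ⟨x, hx.1, hx.2, ?_⟩
  rw [Ultrafilter.coe_map] at hxle
  exact hxle

/-- Along an ultrafilter on `ℕ`, a bounded `ℕ`-valued sequence is eventually constant. -/
theorem exists_eventually_eq_ultrafilter_of_le (𝒰 : Ultrafilter ℕ) (u : ℕ → ℕ) (N : ℕ)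
    (h : ∀ n, u n ≤ N) : ∃ v, v ≤ N ∧ ∀ᶠ n in (𝒰 : Filter ℕ), u n = v := by
  have hmem : Set.Iic N ∈ 𝒰.map u := by
    rw [Ultrafilter.mem_map]
    exact Filter.univ_mem' fun n => h n
  obtain ⟨v, hv, hpure⟩ := Ultrafilter.eq_pure_of_finite_mem (Set.finite_Iic N) hmem
  refine ⟨v, hv, ?_⟩
  have : ({v} : Set ℕ) ∈ 𝒰.map u := by
    rw [hpure]; exact Set.mem_singleton v
  rw [Ultrafilter.mem_map] at this
  filter_upwards [this] with n hn
  simpa using hn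

/-- **Limit extraction for SpectralPin.** See the module docstring. -/
theorem levelTwo_minor_of_sequences (b δ₀ : ℝ) (hδ₀ : 0 < δ₀)
    (κ K₁ K₂ : Fin 2 → Fin 2 → ℝ) (C_P m_P : ℝ) (hκ : ∀ p q, 0 < κ p q)
    (Φ : Fin 2 → Fin 2 → ℝ → ℝ)
    (hPKE : ∀ p q, ∀ m : ℝ, m_P ≤ m →
      |Φ p q m - κ p q * (Real.exp (-(b * Real.pi * m)) +
        K₁ p q * Real.exp (-((b + 1) * Real.pi * m)) +
        K₂ p q * Real.exp (-((b + 2) * Real.pi * m)))| ≤ C_P * Real.exp (-((b + 3) * Real.pi * m)))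
    (Kmax : ℕ) (C₀ : ℝ) (k₂ : ℕ → ℕ) (hk₂ : ∀ n, k₂ n ≤ Kmax)
    (ψ : ℕ → ℝ) (g : ℕ → ℕ → ℝ) (a : ℕ → Fin 2 → Fin 2 → ℝ) (c : ℕ → ℕ → Fin 2 → Fin 2 → ℝ)
    (τ : ℕ → ℝ → ℝ) (hτ : ∀ m : ℝ, 1 ≤ m → Tendsto (fun n => τ n m) atTop (𝓝 m))
    (f : ℕ → Fin 2 → Fin 2 → ℝ → ℝ)
    (ψlo ψhi alo ahi : ℝ) (halo : 0 < alo) (n₁ : ℕ)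
    (hg0 : ∀ n, g n 0 = 0)
    (hgb : ∀ n, n₁ ≤ n → ∀ k, 0 ≤ g n k ∧ g n k ≤ 9 / 4 * Real.pi)
    (hgap : ∀ n, n₁ ≤ n → ∀ k, 1 ≤ k → δ₀ ≤ g n k)
    (hwin : ∀ n, n₁ ≤ n → ∀ k, k ≠ k₂ n → g n k ≤ 5 / 4 * Real.pi)
    (hc0 : ∀ n, n₁ ≤ n → ∀ p q, c n 0 p q = 1)
    (hcb : ∀ n, n₁ ≤ n → ∀ k p q, |c n k p q| ≤ C₀)
    (hψb : ∀ n, n₁ ≤ n → ψlo ≤ ψ n ∧ ψ n ≤ ψhi)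
    (hab : ∀ n, n₁ ≤ n → ∀ p q, alo ≤ a n p q ∧ a n p q ≤ ahi)
    (hrank : ∀ n, n₁ ≤ n → (a n 0 0 * c n (k₂ n) 0 0) * (a n 1 1 * c n (k₂ n) 1 1) =
      (a n 0 1 * c n (k₂ n) 0 1) * (a n 1 0 * c n (k₂ n) 1 0))
    (hrep : ∀ n, n₁ ≤ n → ∀ p q, ∀ m : ℝ, 1 ≤ m →
      |f n p q m - a n p q * ∑ k ∈ Finset.range (Kmax + 1),
          c n k p q * Real.exp (-((ψ n + g n k) * τ n m))| ≤
        C₀ * a n p q * Real.exp (-((ψ n + 9 / 4 * Real.pi) * τ n m)))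
    (hconv : ∀ p q, ∀ m : ℝ, 1 ≤ m → Tendsto (fun n => f n p q m) atTop (𝓝 (Φ p q m))) :
    (κ 0 0 * K₂ 0 0) * (κ 1 1 * K₂ 1 1) = (κ 0 1 * K₂ 0 1) * (κ 1 0 * K₂ 1 0) := by
  -- a non-principal ultrafilter finer than `atTop`
  set 𝒰 : Ultrafilter ℕ := Ultrafilter.of atTop with h𝒰
  have hU : (𝒰 : Filter ℕ) ≤ atTop := Ultrafilter.of_le _
  have hev : ∀ᶠ n in (𝒰 : Filter ℕ), n₁ ≤ n := (eventually_ge_atTop n₁).filter_mono hU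
  -- limits of the bounded coordinates
  obtain ⟨ψs, -, -, hψs⟩ := exists_tendsto_ultrafilter_of_bounds 𝒰 ψ ψlo ψhi
    (hev.mono fun n hn => hψb n hn)
  have hga : ∀ k, ∃ x, 0 ≤ x ∧ x ≤ 9 / 4 * Real.pi ∧ Tendsto (fun n => g n k) 𝒰 (𝓝 x) :=
    fun k => exists_tendsto_ultrafilter_of_bounds 𝒰 (fun n => g n k) 0 (9 / 4 * Real.pi)
      (hev.mono fun n hn => hgb n hn k)
  choose gs hgs0 _hgs1 hgs using hga
  have haa : ∀ p q, ∃ x, alo ≤ x ∧ x ≤ ahi ∧ Tendsto (fun n => a n p q) 𝒰 (𝓝 x) :=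
    fun p q => exists_tendsto_ultrafilter_of_bounds 𝒰 (fun n => a n p q) alo ahi
      (hev.mono fun n hn => hab n hn p q)
  choose as has0 _has1 has using haa
  have hca : ∀ k p q, ∃ x, -C₀ ≤ x ∧ x ≤ C₀ ∧ Tendsto (fun n => c n k p q) 𝒰 (𝓝 x) :=
    fun k p q => exists_tendsto_ultrafilter_of_bounds 𝒰 (fun n => c n k p q) (-C₀) C₀
      (hev.mono fun n hn => abs_le.mp (hcb n hn k p q))
  choose cs _ _ hcs using hca
  obtain ⟨k₂s, hk₂s, hk₂ev⟩ := exists_eventually_eq_ultrafilter_of_le 𝒰 k₂ Kmax hk₂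
  -- properties of the limits
  have hgs_zero : gs 0 = 0 := by
    have h1 : Tendsto (fun n => g n 0) 𝒰 (𝓝 0) := by
      simp only [hg0]; exact tendsto_const_nhds
    exact tendsto_nhds_unique (hgs 0) h1
  have hgs_gap : ∀ k, 1 ≤ k → k ≤ Kmax → δ₀ ≤ gs k := fun k hk _ =>
    ge_of_tendsto (hgs k) (hev.mono fun n hn => hgap n hn k hk)
  have hgs_win : ∀ k, k ≤ Kmax → k ≠ k₂s → gs k ≤ 5 / 4 * Real.pi := by
    intro k _ hk
    refine le_of_tendsto (hgs k) ?_
    filter_upwards [hev, hk₂ev] with n hn hn2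
    exact hwin n hn k (by rw [hn2]; exact hk)
  have has_pos : ∀ p q, 0 < as p q := fun p q => lt_of_lt_of_le halo (has0 p q)
  have hcs0 : ∀ p q, cs 0 p q = 1 := by
    intro p q
    have h1 : Tendsto (fun n => c n 0 p q) 𝒰 (𝓝 1) :=
      tendsto_const_nhds.congr' (hev.mono fun n hn => (hc0 n hn p q).symm)
    exact tendsto_nhds_unique (hcs 0 p q) h1
  have hrank_s : (as 0 0 * cs k₂s 0 0) * (as 1 1 * cs k₂s 1 1) =
      (as 0 1 * cs k₂s 0 1) * (as 1 0 * cs k₂s 1 0) := by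
    have hL : Tendsto (fun n => (a n 0 0 * c n k₂s 0 0) * (a n 1 1 * c n k₂s 1 1) -
        (a n 0 1 * c n k₂s 0 1) * (a n 1 0 * c n k₂s 1 0)) 𝒰
        (𝓝 ((as 0 0 * cs k₂s 0 0) * (as 1 1 * cs k₂s 1 1) -
          (as 0 1 * cs k₂s 0 1) * (as 1 0 * cs k₂s 1 0))) :=
      (((has 0 0).mul (hcs k₂s 0 0)).mul ((has 1 1).mul (hcs k₂s 1 1))).sub
        (((has 0 1).mul (hcs k₂s 0 1)).mul ((has 1 0).mul (hcs k₂s 1 0)))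
    have hZ : Tendsto (fun n => (a n 0 0 * c n k₂s 0 0) * (a n 1 1 * c n k₂s 1 1) -
        (a n 0 1 * c n k₂s 0 1) * (a n 1 0 * c n k₂s 1 0)) 𝒰 (𝓝 0) := by
      refine tendsto_const_nhds.congr' ?_
      filter_upwards [hev, hk₂ev] with n hn hn2
      have := hrank n hn
      rw [hn2] at this
      rw [this, sub_self]
    have := tendsto_nhds_unique hL hZ
    linarith
  -- the limit representation on `m ≥ 1`
  have hlim_s : ∀ p q, ∀ m : ℝ, 1 ≤ m →
      |Φ p q m - as p q * ∑ k ∈ Finset.range (Kmax + 1), cs k p q * Real.exp (-((ψs + gs k) * m))| ≤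
        C₀ * as p q * Real.exp (-((ψs + 9 / 4 * Real.pi) * m)) := by
    intro p q m hm
    have hτm : Tendsto (fun n => τ n m) 𝒰 (𝓝 m) := (hτ m hm).mono_left hU
    have hf : Tendsto (fun n => f n p q m) 𝒰 (𝓝 (Φ p q m)) := (hconv p q m hm).mono_left hU
    have hN : Tendsto (fun n => a n p q * ∑ k ∈ Finset.range (Kmax + 1),
        c n k p q * Real.exp (-((ψ n + g n k) * τ n m))) 𝒰
        (𝓝 (as p q * ∑ k ∈ Finset.range (Kmax + 1), cs k p q * Real.exp (-((ψs + gs k) * m)))) := by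
      refine (has p q).mul (tendsto_finsetSum _ fun k _ => ?_)
      refine (hcs k p q).mul (Real.continuous_exp.continuousAt.tendsto.comp ?_)
      exact ((hψs.add (hgs k)).mul hτm).neg
    have hE : Tendsto (fun n => C₀ * a n p q * Real.exp (-((ψ n + 9 / 4 * Real.pi) * τ n m))) 𝒰
        (𝓝 (C₀ * as p q * Real.exp (-((ψs + 9 / 4 * Real.pi) * m)))) := by
      refine ((has p q).const_mul C₀).mul (Real.continuous_exp.continuousAt.tendsto.comp ?_)
      exact ((hψs.add tendsto_const_nhds).mul hτm).neg
    refine le_of_tendsto_of_tendsto (hf.sub hN).abs hE ?_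
    filter_upwards [hev] with n hn
    exact hrep n hn p q m hm
  -- the static core
  exact levelTwo_minor b δ₀ hδ₀ κ K₁ K₂ C_P m_P hκ Φ hPKE Kmax k₂s hk₂s ψs gs hgs_zero hgs_gap
    hgs_win as has_pos cs hcs0 C₀ hrank_s hlim_s

end Summit.CriticalPhenomena.SAWScalingLimit.Theorems.SpectralPin
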